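import Summits.CriticalPhenomena.PercolationContinuityZ3.Theorems.PercNearOneGluingNoHeavyQuantGatedSliceMixLawQAlone
import Summits.CriticalPhenomena.PercolationContinuityZ3.Theorems.PercNearOneGluingNoHeavyQuantGatedSliceMixLawQTwinClosed
import Summits.CriticalPhenomena.PercolationContinuityZ3.Theorems.PercNearOneGluingNoHeavyQuantGatedSliceMixLawQTwinOpen
import Summits.CriticalPhenomena.PercolationContinuityZ3.Theorems.PercNearOneGluingNoHeavyQuantGatedSliceMixLawQTopOpen
import Summits.CriticalPhenomena.PercolationContinuityZ3.Theorems.PercNearOneGluingNoHeavyQuantGatedSliceMixLawQLightTop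
import Summits.CriticalPhenomena.PercolationContinuityZ3.Theorems.PercNearOneGluingNoHeavyQuantGatedSliceMixLawQTwinAbove
import HarnessLib

/-!
# QUANT lane R8, T-DEC, leg (III), blob case — `LawDec.GatedSliceMixLaw'`, the Q-ALONE side: CELL Q4 WITH THE TOP A MID is closed
# (`k₁` a `t`-low or `k₁ = 0`, twin `k₁ + a ≤ j` a mid, top `k₂ ≤ j` a mid, `k₂ + a` a giant ⟹ the moved law `Q` is DEC) — and with it
# cell B-L ∧ `k₂ ≤ j` of regime B

builds on p205010 (kernel theorem, internal audit signed; external expert review pending)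

Support file (`--supports stmt-CriticalPhenomena-4575`), QUANT lane seat prim-quant-arm-1 (gen 41), rung R8 of
`run/shared/lean/prim/quant/LADDER.md`.  Theorems only, standard axioms, no sorries, no definitions.  Pure case assembly of the landed class
theorems `mixLawQ_decAtT_of_noLow` (`k₁ = 0`), `…_twinClosed`, `…_twinOpen`, `…_topOpenHeavy`, `…_lightTop` (twin at or below `t`) and
`…_twinAbove` (twin above `t`).  Memo `run/shared/lean/prim/quant/prim-quant-arm-1-g41/Q-ALONE-G41.md` §2–§4b (exact census: the moved law is
DEC in every instance of these classes; MIDS-FIRST routing certifies all).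

* **`LawDec.mixLawQ_decAtT_cellQ4_topMid`** — the binder of `MixLawCellQ4` (without its unused frame hypotheses) plus `t ≤ 2k₂` and
  `j + 1 ≤ k₂ + a` ⟹ `Q` is `DECAtT y t j (M+a)`.
* `LawDec.gatedSliceMixLaw'_cellQ4_topMid` — the node's conclusion with θ = 0 there.
* **`LawDec.gatedSliceMixLaw'_cellBL_of_top_le`** — lead g32's cell B-L of `MixLawRegimeB` (`…QuantGatedSliceMixLawRegimeBOfCells`, hypothesis
  `hBL` of `mixLawRegimeB_of_cells`) restricted to `k₂ ≤ j`, in that binder's exact shape plus the final hypothesis `k₂ ≤ j`: θ = 0 (in regime B,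
  `t ≤ 2S` forbids a low top, so the top is a mid).  The complementary part `j + 1 ≤ k₂` of B-L is cell B-TWIN (mixtures; typer / census-2).
HONEST STATUS: cell Q4 still lacks its low-top corner (`2k₂ < t`, part of cell QK) and the no-giant corner is `…of_top_le`; cells QK, QH and
the assembly `mixLawCellQ4_holds` remain; `GatedSliceMixLaw'` (regime R), CW, `GateMove`, `GatedConvEmptyFree`, `SingleGateConvClosed`, `TreeDEC`,
`FarTreeRow` OPEN; RATE class log\* / honest sentence unchanged.

[this work]; node: prim-quant-stmt g29/g30, cells: typer g30, cell B-L: lead g32 (this lane).  Nothing here is cited as a published result.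
The gluing rows served [cite: KozmaNitzan2024, Conjecture 3 (p. 15)]; product measure [cite: Grimmett1999, §1.3 p. 10].
-/

noncomputable section

namespace Summit.CriticalPhenomena.PercolationContinuityZ3.Theorems

namespace Quant

open Finset

/-- the two-point law `{lo, hi; g}` (as in `…QuantLawDEC`) -/
local notation3 "TP[" lo ", " hi ", " g ", " h "]" =>
  (g : ℝ) * (if (h : ℕ) = (hi : ℕ) then (1 : ℝ) else 0) + (1 - (g : ℝ)) * (if (h : ℕ) = (lo : ℕ) then (1 : ℝ) else 0)

namespace LawDec

/-- **CELL Q4 WITH THE TOP A MID ⟹ `Q` IS DEC.**  `k₁ ≤ j` with `2k₁ < t` (`k₁ = 0` allowed), twin `k₁ + a ≤ j` with `t ≤ 2(k₁+a)`, top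
`k₂ ≤ j` with `t ≤ 2k₂`, `k₂ + a ≥ j + 1`.  Case assembly of the class theorems (see the file header). [this work] -/
theorem mixLawQ_decAtT_cellQ4_topMid (y z g S lam : ℝ) (a j M k₁ k₂ : ℕ)
    (hy0 : 0 < y) (hy1 : y < 1) (hz0 : 0 ≤ z) (hz1 : z < 1) (hg1 : g ≤ 1) (hyg : y ≤ (1 - z) * g) (ha : 1 ≤ a)
    (hta : y * (M : ℝ) ≤ S) (hk : k₁ ≤ k₂) (hk₂M : k₂ ≤ M) (hlam0 : 0 ≤ lam) (hlam1 : lam ≤ 1)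
    (hmean : (1 - z) * ((k₁ : ℝ) + ((k₂ : ℝ) - k₁) * lam) = S)
    (hk₁j : k₁ ≤ j) (hk₁low : 2 * (k₁ : ℝ) < S + (a : ℝ) * g * (1 - z))
    (hPj : k₁ + a ≤ j) (hPmid : S + (a : ℝ) * g * (1 - z) ≤ 2 * ((k₁ + a : ℕ) : ℝ))
    (hKj : k₂ ≤ j) (hKmid : S + (a : ℝ) * g * (1 - z) ≤ 2 * (k₂ : ℝ)) (hG : j + 1 ≤ k₂ + a) :
    DECAtT y (S + (a : ℝ) * g * (1 - z)) j (M + a)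
      (fun p => z * (if p = 0 then (1 : ℝ) else 0) + (1 - z) * slice (fun q => TP[k₁, k₂, lam, q]) a g p) := by
  have hPr : ((k₁ + a : ℕ) : ℝ) = (k₁ : ℝ) + a := by push_cast; ring
  have hPmid' : S + (a : ℝ) * g * (1 - z) ≤ 2 * ((k₁ : ℝ) + a) := by rw [← hPr]; exact hPmid
  rcases Nat.eq_zero_or_pos k₁ with hk₁0 | hk₁pos
  · -- `k₁ = 0`: no nonzero low (the twin `a` and the top are mids, `k₂ + a` a giant)
    subst hk₁0
    refine mixLawQ_decAtT_of_noLow y z g S lam a j M 0 k₂ hy0 hy1 hz0 hz1 hg1 hyg ha hta hk hk₂M hlam0 hlam1 hmean ?_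
    intro l hl1 hlj hlow
    have hl0 : l ≠ 0 := by omega
    have hla : l ≠ 0 + a := by
      intro h
      have : 2 * (l : ℝ) = 2 * ((0 + a : ℕ) : ℝ) := by rw [h]
      linarith
    have hlK : l ≠ k₂ := by
      intro h
      have : (l : ℝ) = k₂ := by exact_mod_cast h
      linarith
    have hlG : l ≠ k₂ + a := by omega
    rw [mixLawQ_eq_atoms, if_neg hl0, if_neg hla, if_neg hlK, if_neg hlG]
    ring
  · have hk₁ : 1 ≤ k₁ := hk₁pos
    by_cases hPt : (k₁ : ℝ) + a ≤ S + (a : ℝ) * g * (1 - z)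
    · -- the twin at or below `t`
      by_cases hKt : (k₂ : ℝ) ≤ S + (a : ℝ) * g * (1 - z)
      · -- the top at or below `t`
        by_cases hlight : S + (a : ℝ) * g * (1 - z) < (k₁ : ℝ) + k₂
            ∧ S + (a : ℝ) * g * (1 - z) - 2 * (k₁ : ℝ) < y * ((k₂ : ℝ) - k₁)
        · exact mixLawQ_decAtT_lightTop y z g S lam a j M k₁ k₂ hy0 hy1 hz0 hz1 hg1 hyg ha hta hk hk₂M hlam0 hlam1 hmean hk₁ hk₁j
            hk₁low hPj hPt hPmid' hKj hlight.1 hlight.2 hG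
        · have hKheavy : S + (a : ℝ) * g * (1 - z) < (k₁ : ℝ) + k₂ →
              y * ((k₂ : ℝ) - k₁) ≤ S + (a : ℝ) * g * (1 - z) - 2 * (k₁ : ℝ) := by
            intro hc
            by_contra hn
            exact hlight ⟨hc, not_le.1 hn⟩
          by_cases hPclosed : 2 * (k₁ : ℝ) + a ≤ S + (a : ℝ) * g * (1 - z)
          · exact mixLawQ_decAtT_twinClosed y z g S lam a j M k₁ k₂ hy0 hy1 hz0 hz1 hg1 hyg ha hta hk hk₂M hlam0 hlam1 hmean hk₁ hk₁j
              hPclosed hPj hPmid hKj hKmid hKt hKheavy hG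
          · exact mixLawQ_decAtT_twinOpen y z g S lam a j M k₁ k₂ hy0 hy1 hz0 hz1 hg1 hyg ha hta hk hk₂M hlam0 hlam1 hmean hk₁ hk₁j
              hk₁low (not_le.1 hPclosed) hPj hPt hKj hKmid hKt hKheavy hG
      · -- the top above `t`
        have hKopen : S + (a : ℝ) * g * (1 - z) < (k₂ : ℝ) := not_le.1 hKt
        by_cases hKheavy : y * ((k₂ : ℝ) - k₁) ≤ S + (a : ℝ) * g * (1 - z) - 2 * (k₁ : ℝ)
        · exact mixLawQ_decAtT_topOpenHeavy y z g S lam a j M k₁ k₂ hy0 hy1 hz0 hz1 hg1 hyg ha hta hk hk₂M hlam0 hlam1 hmean hk₁ hk₁j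
            hk₁low hPj hPt hPmid' hKj hKopen hKheavy hG
        · have hKcomp : S + (a : ℝ) * g * (1 - z) < (k₁ : ℝ) + k₂ := by
            have : (0 : ℝ) ≤ k₁ := Nat.cast_nonneg k₁
            linarith
          exact mixLawQ_decAtT_lightTop y z g S lam a j M k₁ k₂ hy0 hy1 hz0 hz1 hg1 hyg ha hta hk hk₂M hlam0 hlam1 hmean hk₁ hk₁j
            hk₁low hPj hPt hPmid' hKj hKcomp (not_le.1 hKheavy) hG
    · -- the twin above `t`
      exact mixLawQ_decAtT_twinAbove y z g S lam a j M k₁ k₂ hy0 hy1 hz0 hz1 hg1 hyg ha hta hk hk₂M hlam0 hlam1 hmean hk₁ hk₁j hk₁low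
        hPj (not_le.1 hPt) hKj hKmid hG

/-- **`GatedSliceMixLaw'` with θ = 0 in cell Q4 with the top a mid.** [this work] -/
theorem gatedSliceMixLaw'_cellQ4_topMid (y z g S lam : ℝ) (a j M h k₁ k₂ : ℕ)
    (hy0 : 0 < y) (hy1 : y < 1) (hz0 : 0 ≤ z) (hz1 : z < 1) (hg1 : g ≤ 1) (hyg : y ≤ (1 - z) * g) (ha : 1 ≤ a)
    (hta : y * (M : ℝ) ≤ S) (hk : k₁ ≤ k₂) (hk₂M : k₂ ≤ M) (hlam0 : 0 ≤ lam) (hlam1 : lam ≤ 1)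
    (hmean : (1 - z) * ((k₁ : ℝ) + ((k₂ : ℝ) - k₁) * lam) = S)
    (hk₁j : k₁ ≤ j) (hk₁low : 2 * (k₁ : ℝ) < S + (a : ℝ) * g * (1 - z))
    (hPj : k₁ + a ≤ j) (hPmid : S + (a : ℝ) * g * (1 - z) ≤ 2 * ((k₁ + a : ℕ) : ℝ))
    (hKj : k₂ ≤ j) (hKmid : S + (a : ℝ) * g * (1 - z) ≤ 2 * (k₂ : ℝ)) (hG : j + 1 ≤ k₂ + a) :
    ∃ θ : ℝ, 0 ≤ θ ∧ θ < 1 ∧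
      DECAtT y (S + (a : ℝ) * g * (1 - z)) j (M + a)
        (fun p => θ * weakMidLaw S g h a p
          + (1 - θ) * (z * (if p = 0 then (1 : ℝ) else 0) + (1 - z) * slice (fun q => TP[k₁, k₂, lam, q]) a g p)) := by
  refine ⟨0, le_rfl, zero_lt_one, ?_⟩
  refine decAtT_congr (fun p => ?_)
    (mixLawQ_decAtT_cellQ4_topMid y z g S lam a j M k₁ k₂ hy0 hy1 hz0 hz1 hg1 hyg ha hta hk hk₂M hlam0 hlam1 hmean hk₁j hk₁low hPj
      hPmid hKj hKmid hG)
  ring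

/-- **CELL B-L OF REGIME B WITH `k₂ ≤ j` ⟹ θ = 0.**  The hypothesis `hBL` of `mixLawRegimeB_of_cells` (`…QuantGatedSliceMixLawRegimeBOfCells`)
in its exact shape, plus `k₂ ≤ j`.  In regime B (`t ≤ 2S`) a low top `2k₂ < t` is impossible (`S ≤ k₂`), so the top is a mid and
`mixLawQ_decAtT_cellQ4_topMid` applies; the weak-mid law and `h` are not used. [this work] -/
theorem gatedSliceMixLaw'_cellBL_of_top_le :
    ∀ (y z g S lam : ℝ) (a j M h k₁ k₂ : ℕ),
      0 < y → y < 1 → 0 ≤ z → z < 1 → g ≤ 1 → y ≤ (1 - z) * g → 1 ≤ a → j < M + a → 0 < S → y * (M : ℝ) ≤ S →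
      h ≤ j → h ≤ M → S < (h : ℝ) →
      ¬ DECAtT y (S + (a : ℝ) * g * (1 - z)) j (M + a) (weakMidLaw S g h a) →
      k₁ ≤ k₂ → k₂ ≤ M → 0 ≤ lam → lam ≤ 1 → (1 - z) * ((k₁ : ℝ) + ((k₂ : ℝ) - k₁) * lam) = S →
      k₁ ≤ j → 2 * (k₁ : ℝ) < S + (a : ℝ) * g * (1 - z) → k₁ + a ≤ j → j + 1 ≤ k₂ + a →
      S + (a : ℝ) * g * (1 - z) ≤ 2 * S → j + 1 ≤ h + a →
      S + (a : ℝ) * g * (1 - z) ≤ 2 * ((k₁ + a : ℕ) : ℝ) →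
      k₂ ≤ j →
      ∃ θ : ℝ, 0 ≤ θ ∧ θ < 1 ∧
        DECAtT y (S + (a : ℝ) * g * (1 - z)) j (M + a)
          (fun p => θ * weakMidLaw S g h a p
            + (1 - θ) * (z * (if p = 0 then (1 : ℝ) else 0) + (1 - z) * slice (fun q => TP[k₁, k₂, lam, q]) a g p)) := by
  intro y z g S lam a j M h k₁ k₂ hy0 hy1 hz0 hz1 hg1 hyg ha _hjM _hS0 hta _hhj _hhM _hSh _hW hk hk₂M hlam0 hlam1 hmean
    hk₁j hk₁low hPj hG ht2S _hhaG hPmid hKj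
  have hKmid : S + (a : ℝ) * g * (1 - z) ≤ 2 * (k₂ : ℝ) := by
    -- `S ≤ (1−z)·k₂ ≤ k₂`
    have hkr : (k₁ : ℝ) ≤ k₂ := by exact_mod_cast hk
    have h1 : (k₁ : ℝ) + ((k₂ : ℝ) - k₁) * lam ≤ k₂ := by nlinarith
    have h0 : 0 ≤ (k₁ : ℝ) + ((k₂ : ℝ) - k₁) * lam := by
      have : (0 : ℝ) ≤ k₁ := Nat.cast_nonneg k₁
      nlinarith
    have h2 : (1 - z) * ((k₁ : ℝ) + ((k₂ : ℝ) - k₁) * lam) ≤ 1 * ((k₁ : ℝ) + ((k₂ : ℝ) - k₁) * lam) :=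
      mul_le_mul_of_nonneg_right (by linarith) h0
    linarith
  exact gatedSliceMixLaw'_cellQ4_topMid y z g S lam a j M h k₁ k₂ hy0 hy1 hz0 hz1 hg1 hyg ha hta hk hk₂M hlam0 hlam1 hmean hk₁j hk₁low
    hPj hPmid hKj hKmid hG

end LawDec

end Quant

end Summit.CriticalPhenomena.PercolationContinuityZ3.Theorems
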